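import Literature.AnabelianGeometry.SemiGraphs.ArithLevelKernelInnerCharTowerBranches
import Literature.AnabelianGeometry.SemiGraphs.ArithLevelKerCongruenceSelfNormalizingChart
import HarnessLib

/-!
# [SemiAnbd] Thm 5.4 (i) p. 66, producer T54-B: «hUρ» at the characteristic tower for EVERY `𝒢` with a
# branch — the branch-pair system from ONE branch by total elevation (proof-only)

Mochizuki, *Semi-graphs of anabelioids*, Publ. RIMS **42** (2006), §2 Def 2.4 (i) p. 25 (elevated vertices),
§3 Prop 3.6 (iii) p. 38, Thm 3.7 (i)/(iii) pp. 40–41, §5 Thm 5.4 (i) p. 66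
[cite: MochizukiSemiAnbd2006, Thm 5.4 (i) p.66].

PROOF-ONLY sequel of `ArithLevelKernelInnerCharTower(Branches).lean` (abc-iut cell, layer L3, row T54-B
«char-tower hR/hnobp», seat abc-iut-w4-d085 gen 5).  The previous file supplied the compatible branch-pair
system of the finite coset levels from a vertex with TWO distinct branches of `𝔾`.  ONE branch `b : e → v`
suffices: the branches `[b, (s b)⁻¹]` and `[b, (s b)⁻¹ h]` of the level-`L_i` coset semi-graph both abut
`H_v·1·L_i` for `h ∈ H_v`, and they are DISTINCT as soon as `h ∉ (s_b M_e s_b⁻¹)·L_i`; such an `h` exists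
from a deep level `j₀` on because the positioned branch group `B := s_b M_e s_b⁻¹` is compact, the finite
levels are open with trivial intersection (`hR`, [SemiAnbd] Prop 3.6 (iii) along characteristic levels)
— so `⋂ᵢ B·L_i = B` (abc-iut-L3-t11's `iInter_mul_coe_eq_of_isCompact`) — and `H_v ≰ B` (total
ELEVATION, Def 2.4 (i): `branchSubgroup_ne_top`, through Thm 3.7 (i) at the chart of the tower —
abc-iut-w6-d117's `GaloisLevelData.exists_forall_not_H_le_conj_M_sup_ker_chart`).

* `SemiGraph.SubgroupPresentation.eq_bot_of_isCompact_of_forall_deckAct_eq_one_of_not_le` — `hnobp ⟸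
  hnobpNCpt` at any subgroup presentation with open antitone separating levels, a compact positioned
  branch group `B` at `v` and `H_v ≰ B`;
* `GaloisLevelData.mem_ker_of_mem_iInf_map_ker_arithAct_chart_outerAction_of_branch` — «hUρ» at the chart
  of any cofinal Galois tower with characteristic (`hker`) and vertex-faithful (`hfaithV`) levels, for
  every `𝒢` with a branch abutting a vertex;
* `GaloisLevelData.ofCharCores_mem_ker_of_mem_iInf_map_ker_arithAct_outerAction_of_branch` — **«hUρ» AT
  the CHARACTERISTIC tower, every tower input a term**, for every finite coherent `𝒢` satisfying the
  hypotheses of Thm 3.7 and having at least one branch abutting a vertex; residual = the presentation's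
  `hP`/`hN` (terms of record at the design data).

HONEST FRAME: one-vertex EDGELESS `𝒢` remains excluded («hUρ» false there unless `ρ′ = 1`, abc-iut-w4-d071);
every connected `𝒢` with an edge abutting a vertex is now covered.  No definition, no new named fact;
nothing here refers to the IUT corpus; no side is taken on [IUTchIII] Cor 3.12; typed ≠ proved for the
inputs left as binders.
-/

namespace Literature.AnabelianGeometry.SemiGraphs

open CategoryTheory Topology Filter
open scoped Pointwise

universe u v

namespace SemiGraph

namespace SubgroupPresentation

variable {𝔾 : SemiGraph.{u}} {Γ : Type u} [Group Γ] [TopologicalSpace Γ] [IsTopologicalGroup Γ] [T2Space Γ]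
  (P : SubgroupPresentation 𝔾 Γ)

/-- **`hnobp ⟸ hnobpNCpt` from ONE branch.** Open antitone levels `L n` separating points (`hR`), a branch
`b : e → v` whose positioned branch group `B := s_b M_e s_b⁻¹` is compact and does NOT contain `H_v`: then
some `h ∈ H_v` lies outside `B·L_{j₀}` (`⋂ᵢ B·L_i = B`), the branches `[b, (s b)⁻¹] ≠ [b, (s b)⁻¹ h]` at
`H_v·1·L_i` (`i ≥ j₀`) form a compatible branch-pair system, and the branch-pair test `hnobpNCpt` yields
`hnobp`. [cite: MochizukiSemiAnbd2006, Thm 5.4 (i) p.66] -/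
theorem eq_bot_of_isCompact_of_forall_deckAct_eq_one_of_not_le
    (L : ℕ → Subgroup Γ) [∀ n, (L n).Normal] (hLanti : ∀ ⦃i j : ℕ⦄, i ≤ j → L j ≤ L i)
    (hLopen : ∀ n, IsOpen (L n : Set Γ)) (hR : ∀ g : Γ, (∀ n, g ∈ L n) → g = 1)
    {E : Type v} [Group E] {Φ : E →* MulAut Γ} {σ : E →* Aut 𝔾} (hP : P.IsArithCompatible Φ σ)
    (hLst : ∀ (n : ℕ) (e : E) (x : Γ), x ∈ L n → Φ e x ∈ L n)
    (ι : Γ →* E) (hιΦ : ∀ g, Φ (ι g) = MulAut.conj g) (hισ : ∀ g, σ (ι g) = 1)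
    (hnobpNCpt : ∀ (C : Subgroup Γ), IsCompact (C : Set Γ) →
      ∀ (j₀ : ℕ) (w : ∀ i : {i : ℕ // j₀ ≤ i}, (P.cosetGraph (L i.1)).Vertex)
      (β β' : ∀ i : {i : ℕ // j₀ ≤ i}, (P.cosetGraph (L i.1)).Branch),
      (∀ i, β i ≠ β' i ∧ (P.cosetGraph (L i.1)).abuts (β i) = some (w i) ∧
        (P.cosetGraph (L i.1)).abuts (β' i) = some (w i)) →
      (∀ ⦃i i' : {i : ℕ // j₀ ≤ i}⦄ (h : i.1 ≤ i'.1),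
        (P.cosetGraphTrans (hLanti h)).vertexMap (w i') = w i ∧
        (P.cosetGraphTrans (hLanti h)).branchMap (β i') = β i ∧
          (P.cosetGraphTrans (hLanti h)).branchMap (β' i') = β' i) →
      (∀ (i : {i : ℕ // j₀ ≤ i}) (γ : C),
        (P.arithAct hP (L i.1) (hLst i.1) (ι γ)).hom.vertexMap (w i) = w i ∧
        (P.arithAct hP (L i.1) (hLst i.1) (ι γ)).hom.branchMap (β i) = β i ∧
          (P.arithAct hP (L i.1) (hLst i.1) (ι γ)).hom.branchMap (β' i) = β' i) →
        C = ⊥)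
    {v : 𝔾.Vertex} {b : 𝔾.Branch} (hb : 𝔾.abuts b = some v)
    (hBc : IsCompact ((((P.M (𝔾.edgeOf b)).map (MulAut.conj (P.s b)).toMonoidHom : Subgroup Γ)) : Set Γ))
    (hne : ¬ P.H v ≤ (P.M (𝔾.edgeOf b)).map (MulAut.conj (P.s b)).toMonoidHom) :
    ∀ C : Subgroup Γ, IsCompact (C : Set Γ) → (∀ n (t : C), P.deckAct (L n) (t : Γ) = 1) → C = ⊥ := by
  obtain ⟨h, hhH, hhB⟩ := SetLike.not_le_iff_exists.mp hne
  have hdir : ∀ i j : ℕ, ∃ k, L k ≤ L i ∧ L k ≤ L j :=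
    fun i j => ⟨max i j, hLanti (le_max_left i j), hLanti (le_max_right i j)⟩
  have key := iInter_mul_coe_eq_of_isCompact L hLopen hdir hR hBc
  -- a level `j₀` from which on `h ∉ B·L_i`
  have hnm : h ∉ ⋂ n, (((P.M (𝔾.edgeOf b)).map (MulAut.conj (P.s b)).toMonoidHom : Subgroup Γ) : Set Γ) *
      (L n : Set Γ) := by
    rw [key]
    exact hhB
  obtain ⟨j₀, hj₀⟩ : ∃ j₀ : ℕ,
      h ∉ (((P.M (𝔾.edgeOf b)).map (MulAut.conj (P.s b)).toMonoidHom : Subgroup Γ) : Set Γ) * (L j₀ : Set Γ) :=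
    not_forall.mp fun hall => hnm (Set.mem_iInter.mpr hall)
  have hnot : ∀ i : {i : ℕ // j₀ ≤ i},
      h ∉ (((P.M (𝔾.edgeOf b)).map (MulAut.conj (P.s b)).toMonoidHom : Subgroup Γ) : Set Γ) *
        (L i.1 : Set Γ) :=
    fun i hi => hj₀ (Set.mul_subset_mul_left (SetLike.coe_subset_coe.2 (hLanti i.2)) hi)
  refine P.eq_bot_of_isCompact_of_forall_deckAct_eq_one L hLanti hP hLst ι hιΦ hισ hnobpNCpt j₀
    (fun i => P.vMk (L i.1) v 1) (fun i => P.bMk (L i.1) b (P.s b)⁻¹)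
    (fun i => P.bMk (L i.1) b ((P.s b)⁻¹ * h)) (fun i => ⟨fun heq => hnot i ?_, ?_, ?_⟩)
    (fun _ _ _ => ⟨rfl, rfl, rfl⟩)
  · -- equality of the two branches forces `h ∈ B·L_i`
    have he : P.eMk (L i.1) (𝔾.edgeOf b) (P.s b)⁻¹ = P.eMk (L i.1) (𝔾.edgeOf b) ((P.s b)⁻¹ * h) :=
      congrArg (fun p : (P.cosetGraph (L i.1)).Branch => p.1.2) heq
    rw [P.eMk_eq_eMk_iff, DoubleCoset.eq] at he
    obtain ⟨m, hm, l, hl, hml⟩ := he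
    have hh : h = (P.s b * m * (P.s b)⁻¹) * l := by
      calc h = P.s b * ((P.s b)⁻¹ * h) := by rw [mul_inv_cancel_left]
        _ = P.s b * (m * (P.s b)⁻¹ * l) := by rw [← hml]
        _ = (P.s b * m * (P.s b)⁻¹) * l := by group
    rw [hh]
    exact Set.mul_mem_mul ⟨m, hm, by simp [MulAut.conj_apply]⟩ hl
  · rw [P.cosetGraph_abuts_bMk (L i.1) b v hb, mul_inv_cancel]
  · rw [P.cosetGraph_abuts_bMk (L i.1) b v hb, mul_inv_cancel_left]
    exact congrArg some ((P.vMk_eq_vMk_iff (L i.1)).mpr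
      ((DoubleCoset.eq _ _ _ _).mpr ⟨h⁻¹, (P.H v).inv_mem hhH, 1, (L i.1).one_mem, by group⟩))

end SubgroupPresentation

end SemiGraph

namespace ProfiniteSemiGraph

namespace GaloisLevelData

open Literature.AnabelianGeometry.EtaleTheta
open Literature.AnabelianGeometry.AbsoluteAnabelian (IsTopologicallyFinitelyGenerated)

variable {𝒢 : ProfiniteSemiGraph.{u}} (D : GaloisLevelData 𝒢) (h𝒢 : 𝒢.IsCountable)
  (hcof : ∀ (T : CovObj 𝒢), T.IsTempered → ∀ p : T.Point,
    ∃ i : ℕ, ∀ j, i ≤ j → (D.S j).Splits (T.component p))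
  (hcn : 𝒢.graph.IsConnected) (hS : ∀ n, (D.S n).Splits (D.S n)) (hfin : ∀ n, (D.S n).IsFinite)
  (hne : ∀ n, (D.S n).HasNonemptyFibres)
  (hconn : ∀ (n : ℕ) (p q : (D.S n).Point), (D.S n).SameComponent p q)
  (T : ∀ w : 𝒢.graph.Vertex, D.PointSeq h𝒢 w) (R : SemiGraph.RefBranches 𝒢.graph)

/-- **«hUρ» at the chart of a cofinal Galois tower with characteristic, vertex-faithful levels, for every
`𝒢` with a branch abutting a vertex** — Corollary D of `ArithLevelKernelInner.lean` with ALL tower inputs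
discharged: `hR` (characteristic levels, Prop 3.6 (iii)), `hnobp` (`hnobpNCpt` of abc-iut-w4-d053 from
(I0v) `hfaithV` + the one-branch system: `B` compact as the image of `M_e`, `H_v ≰ B` by abc-iut-w6-d117's
`exists_forall_not_H_le_conj_M_sup_ker_chart`), tree levels `hHK`/`hlift`, `hKst ⟸ hN`.
[cite: MochizukiSemiAnbd2006, Thm 5.4 (i) p.66] -/
theorem mem_ker_of_mem_iInf_map_ker_arithAct_chart_outerAction_of_branch (h37 : 𝒢.Thm37Hypotheses)
    {PA : Type u} [Group PA] (ρ' : PA →* TopOut (D.chart h𝒢 hcof hcn hS hfin hne).G)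
    (baseAct : PA →* Aut 𝒢.graph)
    (hP : (D.piPresentation h𝒢 T R).IsArithCompatible
      (((contMulAut (D.chart h𝒢 hcof hcn hS hfin hne).G).subtype.comp
        (MonoidHom.fst (contMulAut (D.chart h𝒢 hcof hcn hS hfin hne).G) PA)).comp
          (outerSemidirectProduct ρ').subtype)
      (baseAct.comp (outerSemidirectProductSnd ρ')))
    (hN : ∀ (n : ℕ) (e : outerSemidirectProduct ρ') (x : (D.chart h𝒢 hcof hcn hS hfin hne).G),
      x ∈ (D.piLevelAut h𝒢 hconn n).ker →
        (((contMulAut (D.chart h𝒢 hcof hcn hS hfin hne).G).subtype.comp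
          (MonoidHom.fst (contMulAut (D.chart h𝒢 hcof hcn hS hfin hne).G) PA)).comp
            (outerSemidirectProduct ρ').subtype) e x ∈ (D.piLevelAut h𝒢 hconn n).ker)
    (d : ℕ → ℕ) (hker : ∀ n, (D.piLevelAut h𝒢 hconn n).ker = charOpenCore (D.temperedPi h𝒢) (d n))
    (hd : ∀ m : ℕ, ∃ n, m ≤ d n)
    (hfaithV : ∀ (v : 𝒢.graph.Vertex) (h : 𝒢.Gv v),
      (∀ (n : ℕ) (x : ((D.S n).SV v).obj.V), ((D.S n).SV v).obj.ρ h x = x) → h = 1)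
    {v : 𝒢.graph.Vertex} {b : 𝒢.graph.Branch} (hb : 𝒢.graph.abuts b = some v)
    {a : PA} (ha : ∀ n, a ∈ (((D.piPresentation h𝒢 T R).arithAct hP (D.piLevelAut h𝒢 hconn n).ker
      (hN n)).ker).map (outerSemidirectProductSnd ρ')) :
    a ∈ ρ'.ker := by
  haveI : T2Space (D.temperedPi h𝒢) := D.t2Space_temperedPi h𝒢
  haveI : T2Space (D.chart h𝒢 hcof hcn hS hfin hne).G := D.t2Space_temperedPi h𝒢
  haveI : FirstCountableTopology (D.chart h𝒢 hcof hcn hS hfin hne).G := by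
    haveI := (D.chart h𝒢 hcof hcn hS hfin hne).secondCountableTopology
    infer_instance
  haveI hKn : ∀ m : ℕ, @Subgroup.Normal (D.chart h𝒢 hcof hcn hS hfin hne).G
      (D.chart h𝒢 hcof hcn hS hfin hne).group ((D.projAut h𝒢 m).ker) := fun _ => MonoidHom.normal_ker _
  haveI hLn : ∀ n : ℕ, @Subgroup.Normal (D.chart h𝒢 hcof hcn hS hfin hne).G
      (D.chart h𝒢 hcof hcn hS hfin hne).group ((D.piLevelAut h𝒢 hconn n).ker) :=
    fun _ => MonoidHom.normal_ker _
  have hex : (toOuterSemidirectProduct ρ').range = (outerSemidirectProductSnd ρ').ker :=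
    range_toOuterSemidirectProduct_eq_ker ρ'
  have hισ : ∀ g : (D.chart h𝒢 hcof hcn hS hfin hne).G,
      (baseAct.comp (outerSemidirectProductSnd ρ')) ((toOuterSemidirectProduct ρ') g) = 1 := fun g => by
    have hg : (toOuterSemidirectProduct ρ') g ∈ (outerSemidirectProductSnd ρ').ker := hex ▸ ⟨g, rfl⟩
    rw [MonoidHom.comp_apply, (MonoidHom.mem_ker).mp hg, map_one]
  have hR := D.eq_one_of_forall_mem_ker_piLevelAut_of_charOpenCore h𝒢 hcof hcn hS hfin hne hconn
    h37.toProp36Hypotheses d hker hd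
  -- the positioned branch group `B = s_b M_e s_b⁻¹` is compact, and `H_v ≰ B` (total elevation)
  have hBc : IsCompact (((((D.piPresentation h𝒢 T R).M (𝒢.graph.edgeOf b)).map
      (MulAut.conj ((D.piPresentation h𝒢 T R).s b)).toMonoidHom :
        Subgroup (D.temperedPi h𝒢))) : Set (D.temperedPi h𝒢)) := by
    -- `s_b M_e s_b⁻¹ = D_v(Π_b)` (abc-iut-w4-d053's dictionary): the continuous image of the compact `Π_b`
    rw [D.map_conj_s_piPresentation_M h𝒢 T R b v hb, Subgroup.coe_map]
    refine IsCompact.image ?_ (T v).continuous_decompHom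
    unfold ProfiniteSemiGraph.branchSubgroup
    rw [MonoidHom.coe_range]
    exact isCompact_range (map_continuous (𝒢.brHom b v hb))
  obtain ⟨n₀, hn₀⟩ := D.exists_forall_not_H_le_conj_M_sup_ker_chart h37 hcof hcn hS hfin hne T R b v hb
  have hne' : ¬ (D.piPresentation h𝒢 T R).H v ≤ ((D.piPresentation h𝒢 T R).M (𝒢.graph.edgeOf b)).map
      (MulAut.conj ((D.piPresentation h𝒢 T R).s b)).toMonoidHom :=
    fun hle => hn₀ n₀ le_rfl (hle.trans le_sup_left)
  have hnobpNCpt := hnobpNCpt_cosetTower_of_faithV_chart D h𝒢 hcof hcn hS hfin hne hconn T R h37 hP hN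
    (toOuterSemidirectProduct ρ') (fun _ => rfl) hισ hfaithV
  have hnobp := (D.piPresentation h𝒢 T R).eq_bot_of_isCompact_of_forall_deckAct_eq_one_of_not_le
    (fun n => (D.piLevelAut h𝒢 hconn n).ker) (D.ker_piLevelAut_anti h𝒢 hconn)
    (D.isOpen_ker_piLevelAut h𝒢 hconn) hR hP hN (toOuterSemidirectProduct ρ') (fun _ => rfl) hισ
    hnobpNCpt hb hBc hne'
  exact mem_ker_of_mem_iInf_map_ker_arithAct_outerAction (D.chart h𝒢 hcof hcn hS hfin hne) ρ' baseAct
    (D.piPresentation h𝒢 T R) hP hex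
    (fun m => (D.projAut h𝒢 m).ker) (D.ker_projAut_anti h𝒢)
    (D.hKst_of_hLst_outerAction h𝒢 hconn T R ρ' hP hN)
    (D.piPresentation_hHK h𝒢 T R) (D.piPresentation_hlift h𝒢 T R)
    (fun n => (D.piLevelAut h𝒢 hconn n).ker) hN
    (D.ker_projAut_le_ker_piLevelAut h𝒢 hconn) (D.isOpen_ker_piLevelAut h𝒢 hconn)
    (D.ker_piLevelAut_anti h𝒢 hconn) v (D.isCompact_piPresentation_H h𝒢 T R) hR hnobp ha

/-- **«hUρ» AT THE CHARACTERISTIC TOWER for every `𝒢` with a branch — every tower input a term.** For a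
finite semi-graph of anabelioids with topologically finitely generated constituents, satisfying the
hypotheses of Thm 3.7 and having a branch abutting a vertex, at `E := π₁^temp(𝒢) ⋊^out_{ρ′} Π_A` over the
chart of abc-iut-w4-d048's characteristic tower: every `a ∈ Π_A` admitting at every finite level a lift
acting trivially on that level's coset semi-graph has `ρ′ a = 1` (`hker`: abc-iut-w4-d029; `hfaithV`:
abc-iut-w4-d053; elevation at the chart: abc-iut-w6-d117; `hR`/`hnobp`: this lineage); residual = the
presentation's binders `hP`/`hN`. [cite: MochizukiSemiAnbd2006, Thm 5.4 (i) p.66] -/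
theorem ofCharCores_mem_ker_of_mem_iInf_map_ker_arithAct_outerAction_of_branch [Finite 𝒢.graph.Vertex]
    [Finite 𝒢.graph.Branch] (h37 : 𝒢.Thm37Hypotheses) (v₀ : 𝒢.graph.Vertex)
    (hVt : ∀ v : 𝒢.graph.Vertex, IsTopologicallyFinitelyGenerated (𝒢.Gv v))
    (hEt : ∀ e : 𝒢.graph.Edge, IsTopologicallyFinitelyGenerated (𝒢.Ge e))
    (T : ∀ w : 𝒢.graph.Vertex, (GaloisLevelData.ofCharCores h37.toProp36Hypotheses v₀ hVt hEt).PointSeq h37.toProp36Hypotheses.isCountable w)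
    (R : SemiGraph.RefBranches 𝒢.graph)
    {PA : Type u} [Group PA] (ρ' : PA →* TopOut ((GaloisLevelData.ofCharCores h37.toProp36Hypotheses v₀ hVt hEt).chart h37.toProp36Hypotheses.isCountable (ofCharCores_exists_level_splits_component h37.toProp36Hypotheses v₀ hVt hEt) h37.toProp36Hypotheses.isConnected (ofCharCores_splits_self h37.toProp36Hypotheses v₀ hVt hEt) (ofCharCores_isFinite h37.toProp36Hypotheses v₀ hVt hEt) (ofCharCores_hasNonemptyFibres h37.toProp36Hypotheses v₀ hVt hEt)).G) (baseAct : PA →* Aut 𝒢.graph)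
    (hP : ((GaloisLevelData.ofCharCores h37.toProp36Hypotheses v₀ hVt hEt).piPresentation h37.toProp36Hypotheses.isCountable T R).IsArithCompatible (((contMulAut ((GaloisLevelData.ofCharCores h37.toProp36Hypotheses v₀ hVt hEt).chart h37.toProp36Hypotheses.isCountable (ofCharCores_exists_level_splits_component h37.toProp36Hypotheses v₀ hVt hEt) h37.toProp36Hypotheses.isConnected (ofCharCores_splits_self h37.toProp36Hypotheses v₀ hVt hEt) (ofCharCores_isFinite h37.toProp36Hypotheses v₀ hVt hEt) (ofCharCores_hasNonemptyFibres h37.toProp36Hypotheses v₀ hVt hEt)).G).subtype.comp (MonoidHom.fst (contMulAut ((GaloisLevelData.ofCharCores h37.toProp36Hypotheses v₀ hVt hEt).chart h37.toProp36Hypotheses.isCountable (ofCharCores_exists_level_splits_component h37.toProp36Hypotheses v₀ hVt hEt) h37.toProp36Hypotheses.isConnected (ofCharCores_splits_self h37.toProp36Hypotheses v₀ hVt hEt) (ofCharCores_isFinite h37.toProp36Hypotheses v₀ hVt hEt) (ofCharCores_hasNonemptyFibres h37.toProp36Hypotheses v₀ hVt hEt)).G) PA)).comp (outerSemidirectProduct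 ρ').subtype) (baseAct.comp (outerSemidirectProductSnd ρ')))
    (hN : ∀ (n : ℕ) (e : outerSemidirectProduct ρ') (x : ((GaloisLevelData.ofCharCores h37.toProp36Hypotheses v₀ hVt hEt).chart h37.toProp36Hypotheses.isCountable (ofCharCores_exists_level_splits_component h37.toProp36Hypotheses v₀ hVt hEt) h37.toProp36Hypotheses.isConnected (ofCharCores_splits_self h37.toProp36Hypotheses v₀ hVt hEt) (ofCharCores_isFinite h37.toProp36Hypotheses v₀ hVt hEt) (ofCharCores_hasNonemptyFibres h37.toProp36Hypotheses v₀ hVt hEt)).G), x ∈ ((GaloisLevelData.ofCharCores h37.toProp36Hypotheses v₀ hVt hEt).piLevelAut h37.toProp36Hypotheses.isCountable (ofCharCores_sameComponent h37.toProp36Hypotheses v₀ hVt hEt) n).ker →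
      (((contMulAut ((GaloisLevelData.ofCharCores h37.toProp36Hypotheses v₀ hVt hEt).chart h37.toProp36Hypotheses.isCountable (ofCharCores_exists_level_splits_component h37.toProp36Hypotheses v₀ hVt hEt) h37.toProp36Hypotheses.isConnected (ofCharCores_splits_self h37.toProp36Hypotheses v₀ hVt hEt) (ofCharCores_isFinite h37.toProp36Hypotheses v₀ hVt hEt) (ofCharCores_hasNonemptyFibres h37.toProp36Hypotheses v₀ hVt hEt)).G).subtype.comp (MonoidHom.fst (contMulAut ((GaloisLevelData.ofCharCores h37.toProp36Hypotheses v₀ hVt hEt).chart h37.toProp36Hypotheses.isCountable (ofCharCores_exists_level_splits_component h37.toProp36Hypotheses v₀ hVt hEt) h37.toProp36Hypotheses.isConnected (ofCharCores_splits_self h37.toProp36Hypotheses v₀ hVt hEt) (ofCharCores_isFinite h37.toProp36Hypotheses v₀ hVt hEt) (ofCharCores_hasNonemptyFibres h37.toProp36Hypotheses v₀ hVt hEt)).G) PA)).comp (outerSemidirectProduct ρ').subtype) e x ∈ ((GaloisLevelData.ofCharCores h37.toProp36Hypotheses v₀ hVt hEt).piLevelAut h37.toProp36Hypotheses.isCountable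 (ofCharCores_sameComponent h37.toProp36Hypotheses v₀ hVt hEt) n).ker)
    {v : 𝒢.graph.Vertex} {b : 𝒢.graph.Branch} (hb : 𝒢.graph.abuts b = some v)
    {a : PA} (ha : ∀ n, a ∈ ((((GaloisLevelData.ofCharCores h37.toProp36Hypotheses v₀ hVt hEt).piPresentation h37.toProp36Hypotheses.isCountable T R).arithAct hP ((GaloisLevelData.ofCharCores h37.toProp36Hypotheses v₀ hVt hEt).piLevelAut h37.toProp36Hypotheses.isCountable (ofCharCores_sameComponent h37.toProp36Hypotheses v₀ hVt hEt) n).ker (hN n)).ker).map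
      (outerSemidirectProductSnd ρ')) :
    a ∈ ρ'.ker :=
  (GaloisLevelData.ofCharCores h37.toProp36Hypotheses v₀ hVt hEt).mem_ker_of_mem_iInf_map_ker_arithAct_chart_outerAction_of_branch
    h37.toProp36Hypotheses.isCountable (ofCharCores_exists_level_splits_component h37.toProp36Hypotheses v₀ hVt hEt)
    h37.toProp36Hypotheses.isConnected (ofCharCores_splits_self h37.toProp36Hypotheses v₀ hVt hEt)
    (ofCharCores_isFinite h37.toProp36Hypotheses v₀ hVt hEt) (ofCharCores_hasNonemptyFibres h37.toProp36Hypotheses v₀ hVt hEt)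
    (ofCharCores_sameComponent h37.toProp36Hypotheses v₀ hVt hEt) T R h37 ρ' baseAct hP hN (fun k : ℕ => k)
    (ofCharCores_ker_piLevelAut_eq_charOpenCore h37.toProp36Hypotheses v₀ hVt hEt) (fun m => ⟨m, le_rfl⟩)
    (faithfulV_ofCharCores v₀ h37 hVt hEt) hb ha

end GaloisLevelData

end ProfiniteSemiGraph

end Literature.AnabelianGeometry.SemiGraphs
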